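import Literature.Analysis.FluidPDE.HessianLaplacianLp
import HarnessLib

/-!
# Stein's `L^p` Hessian bound for vector fields: the operator norm of `D²w`

Analysis/FluidPDE support file on the decomposition path of the named fact
`Literature.Analysis.FluidPDE.stokes_interior_Lr_estimate` (`FluidPDE/StokesInteriorEstimate`;
T.-P. Tsai, Arch. Rational Mech. Anal. 143 (1998), §3.2 display (3.2): the interior `L^r`
estimate for the Stokes system, Galdi Vol. I / Cattabriga). The whole-space and interior Stokes
estimates are proved in the tree from ONE Calderón–Zygmund primitive, the named fact
`Literature.Analysis.FluidPDE.stein1970_hessian_Lp_bound` (`FluidPDE/HessianLaplacianLp`;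
E. M. Stein, *Singular integrals* (1970), Ch. III §1.3, **Proposition 3**, p. 59: for `f ∈ C²`
with compact support, `‖∂ⱼ∂ₖ f‖_p ≤ A_p ‖Δf‖_p`, `1 < p < ∞`; vendored there for scalar `f` and
directional second derivatives `∂ₐ∂_b f`, `‖a‖, ‖b‖ ≤ 1`).

The velocity part of the Stokes estimates consumes Proposition 3 for **vector fields**
`w ∈ C²_c(ℝ³; ℝ³)` and for the **operator norm of the full second derivative**
`D²w(x) = iteratedFDeriv ℝ 2 w x` (the quantity in `stokes_interior_Lr_estimate`). This file
PROVES that form from the named fact: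

* `stein1970_hessian_Lp_bound.iteratedFDeriv_two`:
  `‖D²w‖_{L^p(ℝ³)} ≤ 27 A_p ‖Δw‖_{L^p(ℝ³)}` for `w ∈ C²_c(ℝ³; ℝ³)`, `1 < p < ∞`

(componentwise: `wₖ = ⟨eₖ, w⟩ ∈ C²_c` has `∂ⱼ∂ᵢwₖ = ⟨eₖ, ∂ⱼ∂ᵢw⟩` and `Δwₖ = ⟨eₖ, Δw⟩`, and
`‖D²w(x)‖ ≤ Σᵢⱼ ‖∂ⱼ∂ᵢw(x)‖ ≤ Σᵢⱼₖ |∂ⱼ∂ᵢwₖ(x)|`), together with the pointwise linear algebra it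
rests on: the bilinear expansion `∂_c∂ₐG = Σᵢⱼ ⟨a,bᵢ⟩⟨c,bⱼ⟩ ∂ⱼ∂ᵢG` in an orthonormal basis
(`fderiv_fderiv_apply_eq_sum_smul`, the two-direction form of the tree's
`fderiv_fderiv_apply_eq_sum`), `∂_c∂ₐG = D²G(c,a)` (`fderiv_fderiv_apply_eq_iteratedFDeriv`),
commutation with continuous linear maps (`fderiv_fderiv_clm_comp_apply`), and the operator-norm
bound `‖D²w(x)‖ ≤ Σᵢⱼ ‖∂ⱼ∂ᵢ w(x)‖` (`norm_iteratedFDeriv_two_le_sum`).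

## Mathlib / tree search

Mathlib: `iteratedFDeriv_two_apply`, `ContinuousLinearMap.iteratedFDeriv_comp_left`,
`ContDiffAt.laplacian_CLM_comp_left`, `ContinuousMultilinearMap.opNorm_le_bound`,
`eLpNorm_sum_le` (all used); no `L^p` Hessian bound of any kind (`Calderon`, `rieszTransform`:
nothing). Tree: `stein1970_hessian_Lp_bound` and its scalar consequences for the truncated
Newtonian potential (`HessianLaplacianLp`, reused, not restated); `fderiv_apply_const_apply`
(`PressurePoisson`), `fderiv_fderiv_apply_eq_sum` (one-direction form, `HessianLaplacian`).

## References

* E. M. Stein, *Singular integrals and differentiability properties of functions*, Princeton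
  Math. Series 30 (1970), Ch. III §1.3, Proposition 3 (p. 59; p. 53 of the held scan)
  [Stein1971].
-/

noncomputable section

open MeasureTheory Function InnerProductSpace
open scoped ENNReal NNReal RealInnerProductSpace Laplacian ContDiff

namespace Literature.Analysis.FluidPDE

/-! ### Bilinear expansion of second directional derivatives in an orthonormal basis -/

section Expansion

variable {E : Type*} [NormedAddCommGroup E] [InnerProductSpace ℝ E]
variable {F : Type*} [NormedAddCommGroup F] [NormedSpace ℝ F]

/-- Expansion of a mixed second directional derivative of a `C²` map in an orthonormal basis:
`∂_c(∂ₐG)(x) = Σᵢ Σⱼ ⟨a,bᵢ⟩⟨c,bⱼ⟩ ∂ⱼ(∂ᵢG)(x)` (bilinearity of `D²G(x)`). [folklore] -/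
theorem fderiv_fderiv_apply_eq_sum_smul {ι : Type*} [Fintype ι] (b : OrthonormalBasis ι ℝ E)
    {G : E → F} (hG : ContDiff ℝ 2 G) (x a c : E) :
    fderiv ℝ (fun y => fderiv ℝ G y a) x c =
      ∑ i, ∑ j, (⟪a, b i⟫ * ⟪c, b j⟫) • fderiv ℝ (fun y => fderiv ℝ G y (b i)) x (b j) := by
  have hD1d : Differentiable ℝ (fderiv ℝ G) :=
    (hG.fderiv_right (m := 1) le_rfl).differentiable one_ne_zero
  have key : ∀ u v : E, fderiv ℝ (fun y => fderiv ℝ G y u) x v = fderiv ℝ (fderiv ℝ G) x v u :=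
    fun u v => fderiv_apply_const_apply (hD1d x) u v
  simp_rw [key]
  set D2 := fderiv ℝ (fderiv ℝ G) x with hD2
  have ha : a = ∑ i, ⟪a, b i⟫ • b i := by
    conv_lhs => rw [← b.sum_repr' a]
    exact Finset.sum_congr rfl fun i _ => by rw [real_inner_comm]
  have hc : c = ∑ j, ⟪c, b j⟫ • b j := by
    conv_lhs => rw [← b.sum_repr' c]
    exact Finset.sum_congr rfl fun j _ => by rw [real_inner_comm]
  conv_lhs => rw [ha, hc]
  simp only [map_sum, map_smul, _root_.sum_apply, _root_.smul_apply,
    Finset.smul_sum, smul_smul]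

/-- A mixed second directional derivative is the second Fréchet derivative at the pair of
directions: `∂_c(∂ₐG)(x) = D²G(x)(c, a)`. [folklore] -/
theorem fderiv_fderiv_apply_eq_iteratedFDeriv {E' : Type*} [NormedAddCommGroup E']
    [NormedSpace ℝ E'] {G : E' → F} (hG : ContDiff ℝ 2 G) (x a c : E') :
    fderiv ℝ (fun y => fderiv ℝ G y a) x c = iteratedFDeriv ℝ 2 G x ![c, a] := by
  have hD1d : Differentiable ℝ (fderiv ℝ G) :=
    (hG.fderiv_right (m := 1) le_rfl).differentiable one_ne_zero
  rw [iteratedFDeriv_two_apply, fderiv_clm_apply (hD1d x) (differentiableAt_const a)]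
  simp

/-- Second directional derivatives commute with continuous linear maps on the left:
`∂_c∂ₐ(L ∘ w) = L (∂_c∂ₐ w)` for `w ∈ C²`. [folklore] -/
theorem fderiv_fderiv_clm_comp_apply {E' : Type*} [NormedAddCommGroup E'] [NormedSpace ℝ E']
    {G' : Type*} [NormedAddCommGroup G'] [NormedSpace ℝ G'] (L : F →L[ℝ] G') {w : E' → F}
    (hw : ContDiff ℝ 2 w) (x a c : E') :
    fderiv ℝ (fun y => fderiv ℝ (fun z => L (w z)) y a) x c =
      L (fderiv ℝ (fun y => fderiv ℝ w y a) x c) := by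
  rw [fderiv_fderiv_apply_eq_iteratedFDeriv (hw.continuousLinearMap_comp L),
    fderiv_fderiv_apply_eq_iteratedFDeriv hw]
  have e : (fun z => L (w z)) = L ∘ w := rfl
  rw [e, L.iteratedFDeriv_comp_left hw.contDiffAt le_rfl]
  rfl

/-- **Operator norm of the second derivative by the mixed partials**: for `w ∈ C²` and an
orthonormal basis `b`, `‖D²w(x)‖ ≤ Σᵢ Σⱼ ‖∂ⱼ∂ᵢ w(x)‖`. [folklore] -/
theorem norm_iteratedFDeriv_two_le_sum {ι : Type*} [Fintype ι] (b : OrthonormalBasis ι ℝ E)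
    {w : E → F} (hw : ContDiff ℝ 2 w) (x : E) :
    ‖iteratedFDeriv ℝ 2 w x‖ ≤ ∑ i, ∑ j, ‖fderiv ℝ (fun y => fderiv ℝ w y (b i)) x (b j)‖ := by
  refine ContinuousMultilinearMap.opNorm_le_bound (by positivity) fun m => ?_
  have hm : iteratedFDeriv ℝ 2 w x m = iteratedFDeriv ℝ 2 w x ![m 0, m 1] := by
    congr 1
    ext i
    fin_cases i <;> rfl
  rw [Fin.prod_univ_two, hm, ← fderiv_fderiv_apply_eq_iteratedFDeriv hw x (m 1) (m 0),
    fderiv_fderiv_apply_eq_sum_smul b hw x (m 1) (m 0)]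
  calc ‖∑ i, ∑ j, (⟪m 1, b i⟫ * ⟪m 0, b j⟫) • fderiv ℝ (fun y => fderiv ℝ w y (b i)) x (b j)‖
      ≤ ∑ i, ∑ j, ‖(⟪m 1, b i⟫ * ⟪m 0, b j⟫) • fderiv ℝ (fun y => fderiv ℝ w y (b i)) x (b j)‖ :=
        (norm_sum_le _ _).trans (Finset.sum_le_sum fun i _ => norm_sum_le _ _)
    _ ≤ ∑ i, ∑ j, ‖fderiv ℝ (fun y => fderiv ℝ w y (b i)) x (b j)‖ * (‖m 0‖ * ‖m 1‖) := by
        gcongr with i _ j _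
        rw [norm_smul, mul_comm]
        gcongr
        rw [norm_mul, Real.norm_eq_abs, Real.norm_eq_abs, mul_comm]
        have hi : |⟪m 1, b i⟫| ≤ ‖m 1‖ := by
          simpa [b.orthonormal.1 i] using abs_real_inner_le_norm (m 1) (b i)
        have hj : |⟪m 0, b j⟫| ≤ ‖m 0‖ := by
          simpa [b.orthonormal.1 j] using abs_real_inner_le_norm (m 0) (b j)
        exact mul_le_mul hj hi (abs_nonneg _) (norm_nonneg _)
    _ = (∑ i, ∑ j, ‖fderiv ℝ (fun y => fderiv ℝ w y (b i)) x (b j)‖) * (‖m 0‖ * ‖m 1‖) := by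
        rw [Finset.sum_mul]
        exact Finset.sum_congr rfl fun i _ => (Finset.sum_mul _ _ _).symm

/-- In an orthonormal basis, `‖v‖ ≤ Σₖ |⟨bₖ, v⟩|`. [folklore] -/
theorem norm_le_sum_abs_inner {ι : Type*} [Fintype ι] (b : OrthonormalBasis ι ℝ E) (v : E) :
    ‖v‖ ≤ ∑ k, |⟪b k, v⟫| := by
  conv_lhs => rw [← b.sum_repr' v]
  refine (norm_sum_le _ _).trans (le_of_eq (Finset.sum_congr rfl fun k _ => ?_))
  rw [norm_smul, b.orthonormal.1 k, mul_one, Real.norm_eq_abs]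

end Expansion

/-! ### Consequences on `ℝ³` -/

/-- Continuity of the mixed second directional derivatives of a `C²` map (vector-valued form of
`continuous_fderiv_fderiv_apply`). [folklore] -/
theorem continuous_fderiv_fderiv_apply' {E : Type*} [NormedAddCommGroup E] [NormedSpace ℝ E]
    {F : Type*} [NormedAddCommGroup F] [NormedSpace ℝ F] {G : E → F} (hG : ContDiff ℝ 2 G)
    (c d : E) : Continuous fun x => fderiv ℝ (fun y => fderiv ℝ G y c) x d :=
  (((hG.fderiv_right (m := 1) le_rfl).clm_apply contDiff_const).continuous_fderiv
    one_ne_zero).clm_apply continuous_const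

/-- **Stein's Proposition 3 for vector fields, operator-norm form.** From
`stein1970_hessian_Lp_bound`: for `1 < p < ∞` there is `A'` (`= 27A_p`) such that for every
`w ∈ C²(ℝ³; ℝ³)` with compact support the full second derivative obeys
`‖D²w‖_{L^p(ℝ³)} ≤ A' ‖Δw‖_{L^p(ℝ³)}`, `D²w(x) = iteratedFDeriv ℝ 2 w x` with its operator norm
(apply the scalar bound to the components `wₖ = ⟨eₖ, w⟩`, whose Laplacian is `⟨eₖ, Δw⟩`).
PROVED from the named fact. [cite: Stein1971, Ch. III §1.3 Prop 3] -/
theorem stein1970_hessian_Lp_bound.iteratedFDeriv_two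
    (h : stein1970_hessian_Lp_bound (EuclideanSpace ℝ (Fin 3)))
    {p : ℝ≥0∞} (hp : 1 < p) (hp' : p < ⊤) :
    ∃ A : ℝ≥0, ∀ w : EuclideanSpace ℝ (Fin 3) → EuclideanSpace ℝ (Fin 3), ContDiff ℝ 2 w →
      HasCompactSupport w →
      eLpNorm (fun x => iteratedFDeriv ℝ 2 w x) p volume ≤ A * eLpNorm (Δ w) p volume := by
  obtain ⟨A, hA⟩ := h p hp hp'
  set eb := EuclideanSpace.basisFun (Fin 3) ℝ with heb
  refine ⟨27 * A, fun w hw hwc => ?_⟩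
  have hp1 : 1 ≤ p := hp.le
  -- the components `wₖ = ⟨eₖ, w⟩ = eₖ* ∘ w`
  set L : Fin 3 → EuclideanSpace ℝ (Fin 3) →L[ℝ] ℝ := fun k => innerSL ℝ (eb k) with hL
  set wc : Fin 3 → EuclideanSpace ℝ (Fin 3) → ℝ := fun k y => L k (w y) with hwc_def
  have hk_cd : ∀ k, ContDiff ℝ 2 (wc k) := fun k => hw.continuousLinearMap_comp (L k)
  have hk_cs : ∀ k, HasCompactSupport (wc k) := fun k =>
    hwc.comp_left (g := fun v => L k v) (map_zero _)
  -- the mixed partials `g i j k = ∂ⱼ∂ᵢ wₖ`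
  set g : Fin 3 → Fin 3 → Fin 3 → EuclideanSpace ℝ (Fin 3) → ℝ := fun i j k x =>
    fderiv ℝ (fun y => fderiv ℝ (wc k) y (eb i)) x (eb j) with hg
  have hg_eq : ∀ i j k x, g i j k x = ⟪eb k, fderiv ℝ (fun y => fderiv ℝ w y (eb i)) x (eb j)⟫ :=
    fun i j k x => by
    simp only [hg, hwc_def]
    rw [fderiv_fderiv_clm_comp_apply (L k) hw x (eb i) (eb j), hL, innerSL_apply_apply]
  have hg_meas : ∀ i j k, AEStronglyMeasurable (g i j k) volume := fun i j k =>
    (continuous_fderiv_fderiv_apply' (hk_cd k) (eb i) (eb j)).aestronglyMeasurable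
  -- the Laplacian of a component is the component of the Laplacian
  have hlap : ∀ k x, ‖(Δ (wc k)) x‖ ≤ ‖(Δ w) x‖ := fun k x => by
    have e : wc k = (L k) ∘ w := rfl
    rw [e, hw.contDiffAt.laplacian_CLM_comp_left, Function.comp_apply, hL, innerSL_apply_apply]
    simpa [eb.orthonormal.1 k] using norm_inner_le_norm (𝕜 := ℝ) (eb k) ((Δ w) x)
  -- pointwise bound of the operator norm by the 27 scalar second partials
  have hpt : ∀ x, ‖iteratedFDeriv ℝ 2 w x‖ ≤ ∑ i, ∑ j, ∑ k, ‖g i j k x‖ := fun x => by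
    refine (norm_iteratedFDeriv_two_le_sum eb hw x).trans (Finset.sum_le_sum fun i _ =>
      Finset.sum_le_sum fun j _ => ?_)
    refine (norm_le_sum_abs_inner eb _).trans (le_of_eq (Finset.sum_congr rfl fun k _ => ?_))
    rw [hg_eq, Real.norm_eq_abs]
  -- integrate
  have hsum_fn : (fun x => ∑ i, ∑ j, ∑ k, ‖g i j k x‖) =
      ∑ i, ∑ j, ∑ k, fun x => ‖g i j k x‖ := by
    funext x
    simp only [Finset.sum_apply]
  calc eLpNorm (fun x => iteratedFDeriv ℝ 2 w x) p volume
      ≤ eLpNorm (fun x => ∑ i, ∑ j, ∑ k, ‖g i j k x‖) p volume := eLpNorm_mono_real hpt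
    _ = eLpNorm (∑ i, ∑ j, ∑ k, fun x => ‖g i j k x‖) p volume := by rw [hsum_fn]
    _ ≤ ∑ i, eLpNorm (∑ j, ∑ k, fun x => ‖g i j k x‖) p volume :=
        eLpNorm_sum_le (fun i _ => Finset.aestronglyMeasurable_sum _ fun j _ =>
          Finset.aestronglyMeasurable_sum _ fun k _ => (hg_meas i j k).norm) hp1
    _ ≤ ∑ i, ∑ j, eLpNorm (∑ k, fun x => ‖g i j k x‖) p volume :=
        Finset.sum_le_sum fun i _ => eLpNorm_sum_le (fun j _ =>
          Finset.aestronglyMeasurable_sum _ fun k _ => (hg_meas i j k).norm) hp1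
    _ ≤ ∑ i, ∑ j, ∑ k, eLpNorm (fun x => ‖g i j k x‖) p volume :=
        Finset.sum_le_sum fun i _ => Finset.sum_le_sum fun j _ =>
          eLpNorm_sum_le (fun k _ => (hg_meas i j k).norm) hp1
    _ ≤ ∑ _i : Fin 3, ∑ _j : Fin 3, ∑ _k : Fin 3, A * eLpNorm (Δ w) p volume := by
        gcongr with i _ j _ k _
        rw [eLpNorm_norm]
        refine (hA (wc k) (hk_cd k) (hk_cs k) (eb i) (eb j) (eb.orthonormal.1 i).le
          (eb.orthonormal.1 j).le).trans ?_
        gcongr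
        exact eLpNorm_mono (hlap k)
    _ = ((27 * A : ℝ≥0) : ℝ≥0∞) * eLpNorm (Δ w) p volume := by
        simp only [Finset.sum_const, Finset.card_univ, Fintype.card_fin, nsmul_eq_mul]
        push_cast
        ring

end Literature.Analysis.FluidPDE

end
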